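import Summits.CriticalPhenomena.PercolationContinuityZ3.Theorems.Transplant.SharpnessSubdividedClusterZd
import Literature.Probability.Percolation.CriticalContinuity
import Literature.Probability.Percolation.BernoulliPercolationProofs
import Mathlib.Analysis.SpecialFunctions.Pow.Real
import HarnessLib

/-!
# `θ_{ℤ^d[L_M]}(p) = θ_{ℤ^d}(p^M)`, `p_c(ℤ^d[L_M]) = p_c(ℤ^d)^{1/M}`, and the SUMMIT as a statement about a quasi-transitive lattice

House module of the `TransplantSharpness` programme (P5-SHARPNESS §44.3).  For the `M`-subdivided lattice `ℤ^d[L^{(d)}_M]`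
(`gridLinesZd`, `SharpnessSubdividedClusterZd`) and every `d ≥ 1`, `M ≥ 1`:

* `theta_subdividedLatticeZd_eq` — `θ_{ℤ^d[L_M]}(0, p) = θ_{ℤ^d}(0, p^M)` (series law on `ℤ^d` + the events identity);
* `criticalProb_subdividedLatticeZd_eq` — `p_c(ℤ^d[L_M]) = p_c(ℤ^d)^{1/M}` (only `θ_{ℤ^d} = 0` below and `> 0` above `p_c(ℤ^d)` are used,
  no value of `p_c(ℤ^d)`);
* `theta_subdividedLatticeZd_criticalProb` — `θ_{ℤ^d[L_M]}(p_c(ℤ^d[L_M])) = θ_{ℤ^d}(p_c(ℤ^d))`;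
* `percolationContinuityZ3_iff_subdividedLattice` — **`PercolationContinuityZ3 ↔ θ_{ℤ³[L_M]}(p_c(ℤ³[L_M])) = 0`**: the summit is
  EQUIVALENT to the Benjamini–Schramm continuity statement for one (any) member of a family of quasi-transitive, non-vertex-transitive,
  amenable graphs with critical points `p_c(ℤ³)^{1/M} → 1`.
-/

noncomputable section

namespace Summit.CriticalPhenomena.PercolationContinuityZ3.Theorems.TransplantSharpness

open MeasureTheory Literature.Probability.Percolation Literature.Probability.LatticeModels

variable {d : ℕ}

/-- **`θ_{ℤ^d[L_M]}(0, p) = θ_{ℤ^d}(0, p^M)`** (`d, M ≥ 1`). [folklore] -/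
theorem theta_subdividedLatticeZd_eq [NeZero d] {M : ℕ} (hM : 1 ≤ M) (p : unitInterval) :
    theta ((zdGraph d).induce (gridLinesZd d M)) ⟨0, zero_mem_gridLinesZd M⟩ p = theta (zdGraph d) (0 : Site d) (p ^ M) := by
  rw [theta_induce_eq_real_percolatesVia (zdGraph d) (gridLinesZd d M) 0 (zero_mem_gridLinesZd M) p,
    percolatesVia_gridLines_eqZd hM,
    bondPercolation_real_preimage_coarseConfigZd p M (measurableSet_percolatesAt_holds (0 : Site d))]
  rfl

/-- `θ_{ℤ^d[L_M]}(0, p) > 0 ⟹ p_c(ℤ^d) ≤ p^M`, and `p^M > p_c(ℤ^d) ⟹ θ_{ℤ^d[L_M]}(0, p) > 0`. [folklore] -/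
theorem theta_subdividedLatticeZd_pos_iff_aux [NeZero d] {M : ℕ} (hM : 1 ≤ M) (p : unitInterval) :
    (0 < theta ((zdGraph d).induce (gridLinesZd d M)) ⟨0, zero_mem_gridLinesZd M⟩ p →
        criticalProb (zdGraph d) 0 ≤ (p : ℝ) ^ M) ∧
      (criticalProb (zdGraph d) 0 < (p : ℝ) ^ M →
        0 < theta ((zdGraph d).induce (gridLinesZd d M)) ⟨0, zero_mem_gridLinesZd M⟩ p) := by
  rw [theta_subdividedLatticeZd_eq hM]
  constructor
  · intro h
    by_contra hlt
    rw [not_le] at hlt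
    have h0 := theta_eq_zero_of_lt_criticalProb_holds (zdGraph d) (0 : Site d) (p ^ M) (by rwa [Set.Icc.coe_pow])
    rw [h0] at h
    exact lt_irrefl _ h
  · intro h
    exact theta_pos_of_criticalProb_lt_holds (zdGraph d) (0 : Site d) (p ^ M) (by rwa [Set.Icc.coe_pow])

/-- **`p_c(ℤ^d[L_M]) = p_c(ℤ^d)^{1/M}`** (`d, M ≥ 1`). [folklore] -/
theorem criticalProb_subdividedLatticeZd_eq [NeZero d] {M : ℕ} (hM : 1 ≤ M) :
    criticalProb ((zdGraph d).induce (gridLinesZd d M)) ⟨0, zero_mem_gridLinesZd M⟩ =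
      (criticalProb (zdGraph d) 0) ^ ((1 : ℝ) / M) := by
  set π := criticalProb (zdGraph d) (0 : Site d) with hπ
  have hπ0 : 0 ≤ π := (criticalProb_mem_Icc _ _).1
  have hπ1 : π ≤ 1 := (criticalProb_mem_Icc _ _).2
  have hMpos : (0 : ℝ) < M := by exact_mod_cast hM
  set c : ℝ := π ^ ((1 : ℝ) / M) with hc
  have hc0 : 0 ≤ c := Real.rpow_nonneg hπ0 _
  have hc1 : c ≤ 1 := Real.rpow_le_one hπ0 hπ1 (by positivity)
  have hcM : c ^ M = π := by
    rw [hc, ← Real.rpow_natCast, ← Real.rpow_mul hπ0, show (1 : ℝ) / M * M = 1 by field_simp, Real.rpow_one]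
  set G := (zdGraph d).induce (gridLinesZd d M)
  set o : gridLinesZd d M := ⟨0, zero_mem_gridLinesZd M⟩
  apply le_antisymm
  · apply le_of_forall_gt_imp_ge_of_dense
    intro q hq
    by_cases hq1 : q ≤ 1
    · have hqI : q ∈ unitInterval := ⟨hc0.trans hq.le, hq1⟩
      have hpos : 0 < theta G o ⟨q, hqI⟩ := by
        refine (theta_subdividedLatticeZd_pos_iff_aux hM ⟨q, hqI⟩).2 ?_
        show π < q ^ M
        rw [← hcM]; exact pow_lt_pow_left₀ hq hc0 (by omega)
      refine csInf_le ⟨0, ?_⟩ (Or.inl ⟨hqI, hpos⟩)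
      rintro r (⟨hr, -⟩ | hr)
      · exact hr.1
      · rw [Set.mem_singleton_iff] at hr
        rw [hr]; exact zero_le_one
    · exact (criticalProb_mem_Icc G o).2.trans (le_of_not_ge hq1)
  · refine le_csInf ⟨1, Or.inr rfl⟩ ?_
    rintro r (⟨hr, hpos⟩ | hr)
    · have hle := (theta_subdividedLatticeZd_pos_iff_aux hM ⟨r, hr⟩).1 hpos
      by_contra hlt
      rw [not_le] at hlt
      have : (r : ℝ) ^ M < c ^ M := pow_lt_pow_left₀ hlt hr.1 (by omega)
      rw [hcM] at this
      exact absurd (lt_of_le_of_lt hle this) (lt_irrefl _)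
    · rw [Set.mem_singleton_iff] at hr
      rw [hr]; exact hc1

/-- **`θ_{ℤ^d[L_M]}` at its own critical point equals `θ_{ℤ^d}` at `p_c(ℤ^d)`.** [folklore] -/
theorem theta_subdividedLatticeZd_criticalProb [NeZero d] {M : ℕ} (hM : 1 ≤ M) :
    theta ((zdGraph d).induce (gridLinesZd d M)) ⟨0, zero_mem_gridLinesZd M⟩
        ⟨criticalProb ((zdGraph d).induce (gridLinesZd d M)) ⟨0, zero_mem_gridLinesZd M⟩, criticalProb_mem_Icc _ _⟩ =
      theta (zdGraph d) (0 : Site d) (criticalProbI d) := by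
  rw [theta_subdividedLatticeZd_eq hM]
  congr 1
  apply Subtype.ext
  have hπ0 : 0 ≤ criticalProb (zdGraph d) (0 : Site d) := (criticalProb_mem_Icc _ _).1
  rw [Set.Icc.coe_pow]
  simp only [criticalProb_subdividedLatticeZd_eq hM, coe_criticalProbI]
  rw [← Real.rpow_natCast, ← Real.rpow_mul hπ0, show (1 : ℝ) / M * (M : ℕ) = 1 by
    have : (0 : ℝ) < M := by exact_mod_cast hM
    field_simp, Real.rpow_one]

/-- **THE SUMMIT ON A QUASI-TRANSITIVE LATTICE**: `PercolationContinuityZ3` (`θ_{ℤ³}(p_c) = 0`) holds iff the `M`-subdivided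
cubic lattice `ℤ³[L^{(3)}_M]` does not percolate at its own critical point `p_c(ℤ³)^{1/M}` — for one, equivalently every,
`M ≥ 1`. [folklore] -/
theorem percolationContinuityZ3_iff_subdividedLattice {M : ℕ} (hM : 1 ≤ M) :
    PercolationContinuityZ3 ↔
      theta ((zdGraph 3).induce (gridLinesZd 3 M)) ⟨0, zero_mem_gridLinesZd M⟩
        ⟨criticalProb ((zdGraph 3).induce (gridLinesZd 3 M)) ⟨0, zero_mem_gridLinesZd M⟩, criticalProb_mem_Icc _ _⟩ = 0 := by
  rw [percolationContinuityZ3_iff, theta_subdividedLatticeZd_criticalProb hM]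

end Summit.CriticalPhenomena.PercolationContinuityZ3.Theorems.TransplantSharpness
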